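import Mathlib.Algebra.Order.Archimedean.Basic
import Mathlib.Algebra.Order.Archimedean.Real.Basic
import Literature.AlgebraicGeometry.Frobenioids.RealificationRPow
import HarnessLib

/-!
# Frobenioids I, Def. 2.4 (i): homomorphisms of realifications are automatically `ℝ_{≥0}`-linear

Mochizuki, *The geometry of Frobenioids I*, Kyushu J. Math. **62** (2008), §2, Definition 2.4 (i) p. 48
and Proposition 5.3 p. 103 [cite: MochizukiFrdI2008, Def. 2.4(i) p.48] [cite: MochizukiFrdI2008, Prop. 5.3 p.103].

Print treats the `ℝ`-vector space `(M^rlf)^gp` (Def. 2.4 (i)) and "the divisor monoid `Φ^rlf`" on a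
category (Prop. 5.3: the pull-back maps `Φ^rlf(f)`, which must be `ℝ`-linear for `ℝ · Φ^birat ⊆ (Φ^rlf)^gp`
to be a monoid on `D`) without comment.  The tacit point is supplied here: **every monoid homomorphism
`φ : M^rlf → N^rlf` between realifications of perf-factorial monoids commutes with the powers
`a ↦ a^r`, `r ∈ ℝ_{≥0}`** (`IsPerfFactorial.Rlf.map_rpow`).  Proof: for rational `r = m/n` the power
`a^{m/n}` is the unique `n`-th root of `a^m` (`M^rlf` is perfect), so `φ` commutes with it; for real `r`,
`a^{q} ≤ a^{r} ≤ a^{q'}` for rationals `q ≤ r ≤ q'`, `φ` is monotone, and the order of `N^rlf` is the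
componentwise/pointwise order of real numbers (`Rlf.dvd_iff_apply_le`), where the rationals are dense
(`Rlf.eq_rpow_of_pinch`).  Theorems only; no statement of the paper is re-typed.
Seat abc-iut-L1-d2 (cell abc-iut), row «FrdI:Def2.4(ii)-ℝ-action + I3-MERGE» (L1-lead R45 (4)).
-/

noncomputable section

namespace Literature.AlgebraicGeometry.Frobenioids

open Function

universe u

/-! ### Two real-number facts: rationals `m/n` are dense in `ℝ_{≥0}`; pinching -/

/-- Between two reals `0 ≤ a < b` there is a fraction `m/n` of natural numbers. [folklore] -/
private theorem exists_nat_div_btwn {a b : ℝ} (ha : 0 ≤ a) (hab : a < b) :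
    ∃ m n : ℕ, 0 < n ∧ a < (m : ℝ) / n ∧ (m : ℝ) / n < b := by
  obtain ⟨q, haq, hqb⟩ := exists_rat_btwn hab
  have hq0 : (0 : ℚ) ≤ q := by
    have h0 : ((0 : ℚ) : ℝ) ≤ (q : ℝ) := by
      rw [Rat.cast_zero]
      exact ha.trans haq.le
    exact_mod_cast h0
  have hnum : 0 ≤ q.num := Rat.num_nonneg.mpr hq0
  have hcast : ((q.num.toNat : ℕ) : ℝ) / (q.den : ℝ) = (q : ℝ) := by
    rw [← Int.cast_natCast, Int.toNat_of_nonneg hnum, Rat.cast_def]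
  exact ⟨q.num.toNat, q.den, q.den_pos, by rw [hcast]; exact haq, by rw [hcast]; exact hqb⟩

/-- Pinching in `ℝ_{≥0}`: if `(m/n) · Y ≤ Z` for all fractions `m/n ≤ r` and `Z ≤ (m/n) · Y` for all
fractions `m/n ≥ r`, then `Z = r · Y`. [folklore] -/
private theorem eq_mul_of_pinch {r Y Z : NNReal}
    (hlo : ∀ m n : ℕ, 0 < n → (m : NNReal) / n ≤ r → (m : NNReal) / n * Y ≤ Z)
    (hhi : ∀ m n : ℕ, 0 < n → r ≤ (m : NNReal) / n → Z ≤ (m : NNReal) / n * Y) : Z = r * Y := by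
  have hlo' : ∀ m n : ℕ, 0 < n → (m : ℝ) / n ≤ (r : ℝ) → (m : ℝ) / n * (Y : ℝ) ≤ (Z : ℝ) :=
    fun m n hn hle => by
      have h1 := hlo m n hn (by exact_mod_cast hle)
      exact_mod_cast h1
  have hhi' : ∀ m n : ℕ, 0 < n → (r : ℝ) ≤ (m : ℝ) / n → (Z : ℝ) ≤ (m : ℝ) / n * (Y : ℝ) :=
    fun m n hn hle => by
      have h1 := hhi m n hn (by exact_mod_cast hle)
      exact_mod_cast h1
  have hr : (0 : ℝ) ≤ r := r.2
  have hY : (0 : ℝ) ≤ Y := Y.2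
  have hZ : (0 : ℝ) ≤ Z := Z.2
  apply NNReal.coe_injective
  rw [NNReal.coe_mul]
  refine le_antisymm ?_ ?_
  · by_contra hlt
    rw [not_le] at hlt
    rcases eq_or_lt_of_le hY with hY0 | hYpos
    · obtain ⟨m, n, hn, hrm, -⟩ := exists_nat_div_btwn hr (lt_add_one (r : ℝ))
      have h1 := hhi' m n hn hrm.le
      rw [← hY0, mul_zero] at h1 hlt
      exact absurd (hlt.trans_le h1) (lt_irrefl _)
    · obtain ⟨m, n, hn, hrm, hmZ⟩ := exists_nat_div_btwn hr ((lt_div_iff₀ hYpos).mpr hlt)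
      have h1 := hhi' m n hn hrm.le
      exact absurd (h1.trans_lt ((lt_div_iff₀ hYpos).mp hmZ)) (lt_irrefl _)
  · by_contra hlt
    rw [not_le] at hlt
    have hYpos : (0 : ℝ) < Y := by
      rcases eq_or_lt_of_le hY with hY0 | hYpos
      · rw [← hY0, mul_zero] at hlt
        exact absurd hlt (not_lt.mpr hZ)
      · exact hYpos
    obtain ⟨m, n, hn, hZm, hmr⟩ :=
      exists_nat_div_btwn (div_nonneg hZ hY) ((div_lt_iff₀ hYpos).mpr hlt)
    have h1 := hlo' m n hn hmr.le
    exact absurd (((div_lt_iff₀ hYpos).mp hZm).trans_le h1) (lt_irrefl _)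

namespace IsPerfFactorial

namespace Rlf

variable {M : Type u} [CommMonoid M] (hM : IsPerfFactorial M)
variable {N : Type u} [CommMonoid N] (hN : IsPerfFactorial N)

/-! ### Rational powers are algebraic, hence preserved by homomorphisms -/

/-- `(a^{m/n})^n = a^m` in `M^rlf`: the power `a^{m/n}` is the (unique) `n`-th root of `a^m`.
[cite: MochizukiFrdI2008, Def. 2.4(i) p.48] -/
theorem rpow_div_pow (m : ℕ) {n : ℕ} (hn : 0 < n) (a : hM.Rlf) :
    rpow hM ((m : NNReal) / n) a ^ n = a ^ m := by
  have hn' : ((n : ℕ) : NNReal) ≠ 0 := Nat.cast_ne_zero.mpr hn.ne'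
  rw [← rpow_natCast hM n, ← rpow_mul, mul_div_cancel₀ _ hn', rpow_natCast]

/-- An element `y` of `M^rlf` with `y^n = a^m` IS `a^{m/n}` (`n`-th powers are injective).
[cite: MochizukiFrdI2008, Def. 2.4(i) p.48] -/
theorem eq_rpow_div_of_pow_eq (m : ℕ) {n : ℕ} (hn : 0 < n) {a y : hM.Rlf} (hy : y ^ n = a ^ m) :
    y = rpow hM ((m : NNReal) / n) a := by
  apply ((isPerfect hM).1 n hn).1
  dsimp only
  rw [hy, rpow_div_pow hM m hn]

/-- **A homomorphism `M^rlf → N^rlf` commutes with the rational powers `a ↦ a^{m/n}`** (they are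
determined algebraically). [cite: MochizukiFrdI2008, Def. 2.4(i) p.48] -/
theorem map_rpow_div (φ : hM.Rlf →* hN.Rlf) (m : ℕ) {n : ℕ} (hn : 0 < n) (a : hM.Rlf) :
    φ (rpow hM ((m : NNReal) / n) a) = rpow hN ((m : NNReal) / n) (φ a) :=
  eq_rpow_div_of_pow_eq hN m hn (by rw [← map_pow, rpow_div_pow hM m hn, map_pow])

/-! ### Pinching: real powers are limits of rational ones for the order of `N^rlf` -/

/-- **Pinching in `N^rlf`.** If `y^{m/n} ≤ z` for all fractions `m/n ≤ r` and `z ≤ y^{m/n}` for all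
fractions `m/n ≥ r`, then `z = y^r`: the order of `N^rlf` is the pointwise order of real numbers
(`Rlf.dvd_iff_apply_le`), in which the fractions are dense. [cite: MochizukiFrdI2008, Def. 2.4(i) p.48] -/
theorem eq_rpow_of_pinch {r : NNReal} {y z : hN.Rlf}
    (hlo : ∀ m n : ℕ, 0 < n → (m : NNReal) / n ≤ r → rpow hN ((m : NNReal) / n) y ∣ z)
    (hhi : ∀ m n : ℕ, 0 < n → r ≤ (m : NNReal) / n → z ∣ rpow hN ((m : NNReal) / n) y) :
    z = rpow hN r y := by
  apply Subtype.ext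
  funext 𝔮
  refine Realification.ext' fun f => Multiplicative.toAdd.injective ?_
  rw [coe_rpow, RlfFactor.rpow_apply, Realification.toAdd_toHom_rpow]
  apply eq_mul_of_pinch
  · intro m n hn hle
    have h1 := (dvd_iff_apply_le hN _ _).mp (hlo m n hn hle) 𝔮 f
    rwa [coe_rpow, RlfFactor.rpow_apply, Realification.toAdd_toHom_rpow] at h1
  · intro m n hn hle
    have h1 := (dvd_iff_apply_le hN _ _).mp (hhi m n hn hle) 𝔮 f
    rwa [coe_rpow, RlfFactor.rpow_apply, Realification.toAdd_toHom_rpow] at h1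

/-! ### Main theorem: homomorphisms of realifications are `ℝ_{≥0}`-equivariant -/

/-- **Every monoid homomorphism `φ : M^rlf → N^rlf` (for perf-factorial `M`, `N`) commutes with the powers
`a ↦ a^r`, `r ∈ ℝ_{≥0}`**: `φ(a^r) = φ(a)^r`.  (So `φ^gp` is `ℝ`-linear on the `ℝ`-vector spaces
`(M^rlf)^gp → (N^rlf)^gp` of Def. 2.4 (i); in particular the pull-backs of "the divisor monoid `Φ^rlf`" of
Prop. 5.3 are `ℝ`-linear.) [cite: MochizukiFrdI2008, Def. 2.4(i) p.48] -/
theorem map_rpow (φ : hM.Rlf →* hN.Rlf) (r : NNReal) (a : hM.Rlf) :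
    φ (rpow hM r a) = rpow hN r (φ a) := by
  apply eq_rpow_of_pinch hN
  · intro m n hn hle
    rw [← map_rpow_div hM hN φ m hn a]
    exact map_dvd φ (rpow_dvd_rpow_of_le hM hle a)
  · intro m n hn hle
    rw [← map_rpow_div hM hN φ m hn a]
    exact map_dvd φ (rpow_dvd_rpow_of_le hM hle a)

/-- The same for the composite homomorphisms: `φ ∘ (−)^r = (−)^r ∘ φ`. [cite: MochizukiFrdI2008, Def. 2.4(i) p.48] -/
theorem comp_rpow (φ : hM.Rlf →* hN.Rlf) (r : NNReal) :
    φ.comp (rpow hM r) = (rpow hN r).comp φ :=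
  MonoidHom.ext fun a => map_rpow hM hN φ r a

/-- An isomorphism `M^rlf ≅ N^rlf` commutes with the powers in both directions.
[cite: MochizukiFrdI2008, Def. 2.4(i) p.48] -/
theorem mulEquiv_symm_rpow (e : hM.Rlf ≃* hN.Rlf) (r : NNReal) (b : hN.Rlf) :
    e.symm (rpow hN r b) = rpow hM r (e.symm b) := by
  apply e.injective
  rw [MulEquiv.apply_symm_apply, ← MulEquiv.coe_toMonoidHom, map_rpow hM hN, MulEquiv.coe_toMonoidHom,
    MulEquiv.apply_symm_apply]

/-- **Homomorphisms of realifications are monotone and reflect nothing less than print needs:** a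
homomorphism `φ : M^rlf → N^rlf` is determined by its values on any set of `ℝ_{≥0}`-generators; here the
form used downstream: `φ(a^r · b) = φ(a)^r · φ(b)`. [cite: MochizukiFrdI2008, Def. 2.4(i) p.48] -/
theorem map_rpow_mul (φ : hM.Rlf →* hN.Rlf) (r : NNReal) (a b : hM.Rlf) :
    φ (rpow hM r a * b) = rpow hN r (φ a) * φ b := by
  rw [map_mul, map_rpow hM hN]

end Rlf

end IsPerfFactorial

end Literature.AlgebraicGeometry.Frobenioids
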